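/- Copyright: the b2b-balaban cell (near-miss cell 7), T⁴-continuum fan-out, lineage t4-ne7b-p1 (row NE7b OWNER, node U5c
COUNT member), gen 55 — RULING R-OWNER-55-1 (d1) «THE LINE IS CLEAN BETWEEN EVENTS».  Released under the licence of the
surrounding project. -/
import Summits.QuantumFields.BalabanUV.T4Continuum.Support.HistoryGenealogyInstantiateMClauses

/-!
# THE LINE IS CLEAN BETWEEN EVENTS: print's cleanliness clause of condition (ii) holds along every line of the process
(re-open object (α) of row NE7b; RULING R-OWNER-55-1 (d1) of the row owner `t4-ne7b-p1` gen 55, companion of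
`HistoryGenealogyLiveIndex` ((ρ0) at the input level); built in-seat by the owner)

Summits-side support leaf of the T⁴-continuum cell (rung (B)+1 on a FINITE torus only; NOT infinite volume, NOT the
mass gap, NOT Clay; NOT a proof of NE7b — the cell's OWN estimate, NOT PRINTED, NOT PROVED).  [folklore] finite
combinatorics over print's process AS DEFINED in the tree (`HistoryGenealogyInstantiateM`: `RunInputM`, `StM`, `vertM`,
`blocksM`, `loneOldM`, `newLineM`, `RdyM`; `…InstantiateMClauses`: `mem_StM_of_inl_mem_blockM`; `…InstantiateMWF`:
`not_inl_mem_vertM_zero`), brick 2 `HistoryTouchComponents` (`tcomp`, `linkedIn_of_touch`, `eq_tcomp_of_mem_of_mem_tcomps`),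
row S1b∕IR-41-2 (`orbit`, `StopsM`) and `B16StoppingRule.StopAt` (conditions (i)∕(ii) with a CLEANLINESS PREDICATE);
nothing printed is asserted, no cite-tagged hypothesis, zero `sorry`.  B15 = [Balaban1989LargeFieldI] p. 177 and B16 =
[Balaban1989LargeFieldII] p. 384 are manuscripts UNDER AUDIT, quoted as LOCATORS only.

WHY (R-OWNER-55-1 (d)).  Once (ρ0) «no dead indices» is typed at the input level (`RunInputM.NoHealing`: every line READY
before the cutoff is renewed), its non-inspection residue is ONE sentence: OUR readiness rule `StopsM L s Rm t E k` fires
where print's 𝐑-trigger does.  Print's trigger is conditions (i)∕(ii) of B15 p. 177 — «(ii) in the preceding N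
renormalization steps no new large field regions were created inside this component, and the previous regions contained in
it satisfy the condition (i) on the corresponding scales» — with «N = R_j» (B16 p. 384).  The tree's `StopsM` is
`B16StoppingRule.StopAt 100 (Rm t k) Clean (orbit L s t E) k` with the cleanliness predicate `Clean := fun _ => True`: the
clause «no new large field regions were created inside this component» is NOT a predicate of the rule but is DELEGATED to the
process (a new region touching a line's image MERGES with it — an event, which restarts the window).  Sub-question (d1) of the
ruling asks whether that delegation loses anything.  THIS FILE ANSWERS IN THE KERNEL: along every line of the process, at
every level strictly after its last event, NO new region of the input touches the line's image (a fortiori none lies inside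
it) — so condition (ii) WITH the cleanliness predicate read geometrically («no new region of that level touches the
component's image», the touch-reading being STRONGER than «inside») is decided by `StopsM` identically on the process.
What remains of (d) is (d2) inclusive∕exclusive window, (d3) memory `Rm`, (d4) within-step order — readings, unchanged.

WHAT IS PROVED.  §1 `newLineM_of_loneOldM_none` ∕ `_some` (the two shapes of a new line), `orbit_succ_shift`.  §2 THE
INVARIANT **`cleanM`** (induction on the level, pattern of `invM`): for every `τ ∈ StM ℓ` — (a) `τ.t ≤ ℓ`, (b) ITS DOMAIN IS
THE ORBIT `τ.D = orbit L s τ.t τ.E (ℓ − τ.t)`, (c) for every level `l` with `τ.t < l ≤ ℓ` and every new region `n ∈ N l`, no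
cube of the orbit image `orbit L s τ.t τ.E (l − τ.t)` TOUCHES a cube of `n.2`; corollaries `D_eq_orbit`,
**`clean_since_last_event`**.  §3 THE READINESS RULE WITH PRINT'S CLEANLINESS CLAUSE: `CleanStep I t E l` («no new region of
level `t + l` touches the orbit image at the relative index `l`»), **`stopAt_clean_iff_stopsM`** — for `τ ∈ StM ℓ` and
`k ≤ ℓ − τ.t`, `StopAt 100 (Rm τ.t k) (CleanStep I τ.t τ.E) (orbit L s τ.t τ.E) k ↔ StopsM L s Rm τ.t τ.E k` — and
**`rdyM_iff_stopAt_clean`** (readiness of a live line = print's (i)∕(ii) with the cleanliness clause, same size letter, same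
memory).

HONEST SCOPE.  Kernel bookkeeping on OUR process definition; it settles sub-question (d1) of R-OWNER-55-1 for the TOUCH
reading of «inside this component» and leaves (d2)–(d4) as readings; nothing of Bałaban's is discharged, valued or asserted;
BY-NAME EFFECT ON THE WALL: NONE (the (ρ0) row's residue wording only); census NONE; NE7b NOT proved; spine 0∕9.  HONEST
DEPENDENCY (cell): continuum YM on T⁴ ⇐ BetaPertH ∧ nine spine estimates (0/9 proved); BetaPertH ⇐ (D1) ∧ (D4) ∧ CAP+tail;
G-an2-4 gates asym, D1 and NE2/3/4.  This file changes none of it.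
-/

open Finset
open Literature.MathematicalPhysics.QuantumFieldTheory.Balaban1983to89
open Literature.MathematicalPhysics.QuantumFieldTheory.Balaban1983to89.B13ScaleTransfer
open Literature.MathematicalPhysics.QuantumFieldTheory.Balaban1983to89.B16SProfile
open Literature.MathematicalPhysics.QuantumFieldTheory.Balaban1983to89.B16MergeGeometry
open Literature.MathematicalPhysics.QuantumFieldTheory.Balaban1983to89.B16MergeHorizon
open Literature.MathematicalPhysics.QuantumFieldTheory.Balaban1983to89.B16StoppingRule
open Summit.QuantumFields.BalabanUV.T4Continuum.HistoryRealise
open Summit.QuantumFields.BalabanUV.T4Continuum.HistoryRealiseMemory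
open Summit.QuantumFields.BalabanUV.T4Continuum.HistoryGenealogyExtraction
open Summit.QuantumFields.BalabanUV.T4Continuum.HistoryGenealogyRealise
open Summit.QuantumFields.BalabanUV.T4Continuum.HistoryTouchComponents

namespace Summit.QuantumFields.BalabanUV.T4Continuum.HistoryGenealogyInstantiate

noncomputable section

open Classical

variable {d : ℕ}

/-! ## §1 The two shapes of a new line; the orbit one step on -/

/-- the orbit of a domain formed at `t`, one relative step on: one S-operation at the ABSOLUTE step `t + k` [folklore] -/
theorem orbit_succ_shift (L : ℕ) (s : ℕ → ℕ) (t : ℕ) (Z : Finset (Pt d)) (k : ℕ) :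
    orbit L s t Z (k + 1) = Sop (ratio L s (t + k)) (orbit L s t Z k) := by
  rw [orbit_succ, ratio_shift]

namespace RunInputM

variable (I : RunInputM d)

/-- an EVENT block (not a lone unrenewed old line): the new line is `(⋃ images, ℓ, ⋃ images)` [folklore] -/
theorem newLineM_of_loneOldM_none {ℓ : ℕ} {T : Finset (Line d ⊕ Lab d)} (h : I.loneOldM ℓ T = none) :
    I.newLineM ℓ T = ⟨fam (I.P ℓ) T, ℓ, fam (I.P ℓ) T⟩ := by
  unfold newLineM; rw [h]

/-- a LONE UNRENEWED old line `τ`: the new line is `(⋃ images, τ.t, τ.E)` [folklore] -/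
theorem newLineM_of_loneOldM_some {ℓ : ℕ} {T : Finset (Line d ⊕ Lab d)} {τ : Line d} (h : I.loneOldM ℓ T = some τ) :
    I.newLineM ℓ T = ⟨fam (I.P ℓ) T, τ.t, τ.E⟩ := by
  unfold newLineM; rw [h]

/-! ## §2 The invariant: domains are orbits, and the line is clean since its last event -/

/-- **THE INVARIANT «CLEAN SINCE THE LAST EVENT».**  For every line `τ` live at level `ℓ`: (a) `τ.t ≤ ℓ`; (b) its current
domain IS the orbit of its last-event domain, `τ.D = orbit L s τ.t τ.E (ℓ − τ.t)`; (c) at every level `l` with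
`τ.t < l ≤ ℓ`, NO new region of level `l` touches the orbit image `orbit L s τ.t τ.E (l − τ.t)` — the line was continued
ALONE at `l` (its block at `l` is the singleton of its parent), and a touching new region would have been in that block.
[folklore] -/
theorem cleanM : ∀ (ℓ : ℕ), ∀ τ ∈ I.StM ℓ,
    τ.t ≤ ℓ ∧ τ.D = orbit I.L I.s τ.t τ.E (ℓ - τ.t) ∧
      ∀ l, τ.t < l → l ≤ ℓ → ∀ n ∈ I.N l, ∀ a ∈ orbit I.L I.s τ.t τ.E (l - τ.t), ∀ c ∈ n.2, ¬ Touch a c := by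
  intro ℓ
  induction ℓ with
  | zero =>
      intro τ hτ
      obtain ⟨T, hT, rfl⟩ := (I.mem_StM_iff).1 hτ
      have hnone : I.loneOldM 0 T = none := by
        by_contra hs
        obtain ⟨τ₀, hs⟩ := Option.ne_none_iff_exists'.1 hs
        obtain ⟨hTe, -⟩ := I.eq_of_loneOldM_eq_some hs
        exact I.not_inl_mem_vertM_zero τ₀ (subset_of_mem_tcomps hT (hTe ▸ Finset.mem_singleton_self _))
      rw [I.newLineM_of_loneOldM_none hnone]
      exact ⟨le_rfl, by simp, fun l hl hl0 => absurd hl0 (by simp at hl; omega)⟩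
  | succ j ih =>
      intro τ hτ
      obtain ⟨T, hT, rfl⟩ := (I.mem_StM_iff).1 hτ
      cases hlo : I.loneOldM (j + 1) T with
      | none =>
          rw [I.newLineM_of_loneOldM_none hlo]
          exact ⟨le_rfl, by simp, fun l hl hlj => absurd hlj (by simp at hl; omega)⟩
      | some τ₀ =>
          obtain ⟨hTe, hnr⟩ := I.eq_of_loneOldM_eq_some hlo
          obtain ⟨hτ₀, -⟩ := I.mem_StM_of_inl_mem_blockM hT (hTe ▸ Finset.mem_singleton_self _)
          obtain ⟨ht, hD, hclean⟩ := ih τ₀ hτ₀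
          have hnl := I.newLineM_of_loneOldM_some hlo
          -- (b) at level `j + 1`: one S-operation of the parent's domain
          have hfam : fam (I.P (j + 1)) T = Sop (ratio I.L I.s j) τ₀.D := by
            rw [hTe, fam_singleton]
            simp [RunInput.P]
          have hD' : fam (I.P (j + 1)) T = orbit I.L I.s τ₀.t τ₀.E (j + 1 - τ₀.t) := by
            rw [hfam, hD, show j + 1 - τ₀.t = (j - τ₀.t) + 1 by omega, orbit_succ_shift, Nat.add_sub_cancel' ht]
          rw [hnl]
          refine ⟨ht.trans (Nat.le_succ j), hD', fun l hl hlj n hn a ha c hc hac => ?_⟩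
          by_cases hlj' : l ≤ j
          · exact hclean l hl hlj' n hn a ha c hc hac
          · have hl1 : l = j + 1 := by omega
            subst hl1
            -- `a` is a cube of the parent's image, `c` one of the new region `n`: they would be linked in the touch graph
            have hv0 : Sum.inl τ₀ ∈ I.vertM (j + 1) (I.PrevM (j + 1)) :=
              subset_of_mem_tcomps hT (hTe ▸ Finset.mem_singleton_self _)
            have hvn : Sum.inr n ∈ I.vertM (j + 1) (I.PrevM (j + 1)) := I.inr_mem_vertM.2 hn
            have haP : a ∈ I.P (j + 1) (Sum.inl τ₀) := by
              rw [← fam_singleton (I.P (j + 1)) (Sum.inl τ₀), ← hTe, hD']; exact ha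
            have hl := linkedIn_of_touch (P := I.P (j + 1)) hv0 hvn haP (show c ∈ I.P (j + 1) (Sum.inr n) from hc) hac
            have hmem : Sum.inr n ∈ tcomp (I.P (j + 1)) (I.vertM (j + 1) (I.PrevM (j + 1))) (Sum.inl τ₀) :=
              mem_tcomp_iff.2 ⟨hvn, hl⟩
            rw [← eq_tcomp_of_mem_of_mem_tcomps hT (hTe ▸ Finset.mem_singleton_self _), hTe] at hmem
            simp at hmem

variable {I}

/-- **THE DOMAIN OF A LIVE LINE IS THE ORBIT OF ITS LAST-EVENT DOMAIN.** [folklore] -/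
theorem D_eq_orbit {ℓ : ℕ} {τ : Line d} (hτ : τ ∈ I.StM ℓ) : τ.D = orbit I.L I.s τ.t τ.E (ℓ - τ.t) :=
  (I.cleanM ℓ τ hτ).2.1

/-- the last event of a live line is not in the future [folklore] -/
theorem t_le_of_mem_StM {ℓ : ℕ} {τ : Line d} (hτ : τ ∈ I.StM ℓ) : τ.t ≤ ℓ := (I.cleanM ℓ τ hτ).1

/-- **CLEAN SINCE THE LAST EVENT**: for a line live at level `ℓ`, at every level `l` with `τ.t < l ≤ ℓ` no new region of
level `l` touches the line's image at `l` — print's «no new large field regions were created inside this component» (B15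
p. 177 (ii)) in the touch reading, for EVERY step since the last event (not only a window of `N`). [folklore] -/
theorem clean_since_last_event {ℓ : ℕ} {τ : Line d} (hτ : τ ∈ I.StM ℓ) {l : ℕ} (hl : τ.t < l) (hlℓ : l ≤ ℓ)
    {n : Lab d} (hn : n ∈ I.N l) {a c : Pt d} (ha : a ∈ orbit I.L I.s τ.t τ.E (l - τ.t)) (hc : c ∈ n.2) : ¬ Touch a c :=
  (I.cleanM ℓ τ hτ).2.2 l hl hlℓ n hn a ha c hc

/-! ## §3 The readiness rule with print's cleanliness clause is `StopsM` on the process -/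

variable (I)

/-- **PRINT'S CLEANLINESS CLAUSE, READ GEOMETRICALLY, for a line with last event `t` and last-event domain `E`**: at the
relative index `l`, no new region of the input at level `t + l` touches the orbit image `S^l(E)` (touch-reading of «no new
large field regions were created inside this component», B15 p. 177 (ii); «inside» is weaker). [folklore] -/
def CleanStep (t : ℕ) (E : Finset (Pt d)) (l : ℕ) : Prop :=
  ∀ n ∈ I.N (t + l), ∀ a ∈ orbit I.L I.s t E l, ∀ c ∈ n.2, ¬ Touch a c

variable {I}

/-- a live line is clean at every positive relative index up to its age [folklore] -/
theorem cleanStep_of_mem_StM {ℓ : ℕ} {τ : Line d} (hτ : τ ∈ I.StM ℓ) {l : ℕ} (hl0 : 0 < l) (hl : l ≤ ℓ - τ.t) :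
    I.CleanStep τ.t τ.E l := by
  intro n hn a ha c hc
  have ht := t_le_of_mem_StM hτ
  refine clean_since_last_event hτ (l := τ.t + l) (by omega) (by omega) hn ?_ hc
  rw [Nat.add_sub_cancel_left]
  exact ha

/-- **CONDITIONS (i)∕(ii) WITH THE CLEANLINESS CLAUSE ⟺ `StopsM`** on a live line, for every relative index within its
age: the tree's readiness rule (cleanliness predicate `True`) loses nothing on the process. [folklore] -/
theorem stopAt_clean_iff_stopsM {ℓ : ℕ} {τ : Line d} (hτ : τ ∈ I.StM ℓ) {k : ℕ} (hk : k ≤ ℓ - τ.t) :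
    StopAt 100 (I.Rm τ.t k) (I.CleanStep τ.t τ.E) (orbit I.L I.s τ.t τ.E) k ↔ StopsM I.L I.s I.Rm τ.t τ.E k := by
  constructor
  · rintro ⟨h0, hI, hN, hall⟩
    exact ⟨h0, hI, hN, fun l h1 h2 => ⟨trivial, (hall l h1 h2).2⟩⟩
  · rintro ⟨h0, hI, hN, hall⟩
    refine ⟨h0, hI, hN, fun l h1 h2 => ⟨cleanStep_of_mem_StM hτ (by omega) (h2.trans hk), (hall l h1 h2).2⟩⟩

/-- **READINESS OF A LIVE LINE = PRINT'S (i)∕(ii) WITH THE CLEANLINESS CLAUSE** (same size letter `100`, same memory `Rm`).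
[folklore] -/
theorem rdyM_iff_stopAt_clean {ℓ : ℕ} {τ : Line d} (hτ : τ ∈ I.StM ℓ) :
    I.RdyM ℓ τ ↔ StopAt 100 (I.Rm τ.t (ℓ - τ.t)) (I.CleanStep τ.t τ.E) (orbit I.L I.s τ.t τ.E) (ℓ - τ.t) :=
  (stopAt_clean_iff_stopsM hτ le_rfl).symm

end RunInputM

end

end Summit.QuantumFields.BalabanUV.T4Continuum.HistoryGenealogyInstantiate
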